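import Mathlib.Analysis.InnerProductSpace.l2Space

/-!
# Hilbert sums of closed subspaces: orthogonality of closed spans, the `IsHilbertSum` packaging,
# and `v = Σ_π P_π v`

Kernel witnesses (cell pub-hodge-repro2, seat p5, Tier 5) for three abstract Hilbert-space
sentences of route/T5-N4-p5.md v12 (A3) STEP 3 (β)–(γ) and STEP 4, in Mathlib's own vocabulary
(`Submodule.IsOrtho`, `OrthogonalFamily`, `IsHilbertSum`, `Submodule.starProjection`, `HasSum`):

* (β) «L_π ⊥ L_{π′}»: if every generating subspace of `L_π` is orthogonal to every generating
  subspace of `L_{π′}`, the closed spans are orthogonal (`isOrtho_topologicalClosure_sSup`).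
* (γ) «L = ⊕̂_π L_π»: a pairwise orthogonal family of closed subspaces with dense sum is a Hilbert
  sum in Mathlib's sense (`isHilbertSum_of_dense`).
* STEP 4 «v = Σ_π P_π v»: in an internal Hilbert sum the orthogonal projections of `v` onto the
  summands sum to `v` (`hasSum_starProjection`); hence a non-zero `v` has a non-zero component
  (`exists_starProjection_ne_zero_of_ne_zero`; the ad-hoc form without `IsHilbertSum` is `T5IsotypicHilbertSum.exists_starProjection_ne_zero`, not imported), and `v` lies in the summand `L i₀` iff all its other
  components vanish (`mem_iff_forall_starProjection_eq_zero`) — the form in which STEP 4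
  concludes «v = P_{π_∞} v for v ∈ π₀, i.e. π₀ ⊂ L_{π_∞}».

Nothing about groups, representations or the printed theorems [Bo72] 5.4–5.5 is asserted; the
isotypic subspaces `L_π`, their stability and the Schur-lemma steps stay prose in (A3).
Mathlib only.
-/

open scoped InnerProductSpace

namespace Summit.Ventures.HodgeRepro2.T5HilbertSumProjections

variable {𝕜 E : Type*} [RCLike 𝕜] [NormedAddCommGroup E] [InnerProductSpace 𝕜 E]

/-! ### (β) Orthogonality passes to closed spans -/

/-- If `U ⟂ V` then the closure of `U` is still orthogonal to `V` (`Vᗮ` is closed). -/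
theorem IsOrtho.topologicalClosure_left {U V : Submodule 𝕜 E} (h : U ⟂ V) :
    U.topologicalClosure ⟂ V :=
  Submodule.isOrtho_iff_le.mpr
    (U.topologicalClosure_minimal (Submodule.isOrtho_iff_le.mp h) (Submodule.isClosed_orthogonal V))

/-- If `U ⟂ V` then `U ⟂ closure V`. -/
theorem IsOrtho.topologicalClosure_right {U V : Submodule 𝕜 E} (h : U ⟂ V) :
    U ⟂ V.topologicalClosure :=
  (IsOrtho.topologicalClosure_left h.symm).symm

/-- If `U ⟂ V` then `closure U ⟂ closure V`. -/
theorem IsOrtho.topologicalClosure {U V : Submodule 𝕜 E} (h : U ⟂ V) :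
    U.topologicalClosure ⟂ V.topologicalClosure :=
  IsOrtho.topologicalClosure_right (IsOrtho.topologicalClosure_left h)

/-- (β): if every member of `𝒮` is orthogonal to every member of `𝒮'`, the closed spans of `𝒮`
and of `𝒮'` are orthogonal. -/
theorem isOrtho_topologicalClosure_sSup {𝒮 𝒮' : Set (Submodule 𝕜 E)}
    (h : ∀ U ∈ 𝒮, ∀ U' ∈ 𝒮', U ⟂ U') :
    (sSup 𝒮).topologicalClosure ⟂ (sSup 𝒮').topologicalClosure :=
  IsOrtho.topologicalClosure
    (Submodule.isOrtho_sSup_left.mpr fun U hU =>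
      Submodule.isOrtho_sSup_right.mpr fun U' hU' => h U hU U' hU')

/-- The same for indexed families of generators. -/
theorem isOrtho_topologicalClosure_iSup {ι ι' : Sort*} {U : ι → Submodule 𝕜 E}
    {U' : ι' → Submodule 𝕜 E} (h : ∀ i i', U i ⟂ U' i') :
    (⨆ i, U i).topologicalClosure ⟂ (⨆ i', U' i').topologicalClosure :=
  IsOrtho.topologicalClosure
    (Submodule.isOrtho_iSup_left.mpr fun i => Submodule.isOrtho_iSup_right.mpr fun i' => h i i')

/-! ### (γ) The `IsHilbertSum` packaging -/

/-- A pairwise orthogonal family of closed subspaces of a Hilbert space whose sum is dense is a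
Hilbert sum (Mathlib's `IsHilbertSum`, with the inclusions `subtypeₗᵢ`). -/
theorem isHilbertSum_of_dense [CompleteSpace E] {ι : Type*} (L : ι → Submodule 𝕜 E)
    (hclosed : ∀ i, IsClosed (L i : Set E)) (horth : Pairwise fun i j => L i ⟂ L j)
    (hdense : (⨆ i, L i).topologicalClosure = ⊤) :
    IsHilbertSum 𝕜 (fun i => L i) fun i => (L i).subtypeₗᵢ := by
  haveI : ∀ i, CompleteSpace (L i) := fun i => (hclosed i).isComplete.completeSpace_coe
  exact IsHilbertSum.mkInternal _ (OrthogonalFamily.of_pairwise horth) hdense.symm.le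

/-- Variant: the closed subspaces are given as the closures of a pairwise orthogonal family of
(not necessarily closed) subspaces whose sum is dense — exactly the shape of (γ), where each
`L_π` is the closed span of its generating copies. -/
theorem isHilbertSum_topologicalClosure_of_dense [CompleteSpace E] {ι : Type*}
    (N : ι → Submodule 𝕜 E) (horth : Pairwise fun i j => N i ⟂ N j)
    (hdense : (⨆ i, N i).topologicalClosure = ⊤) :
    IsHilbertSum 𝕜 (fun i => (N i).topologicalClosure)
      fun i => (N i).topologicalClosure.subtypeₗᵢ := by
  refine isHilbertSum_of_dense _ (fun i => Submodule.isClosed_topologicalClosure _)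
    (fun i j hij => IsOrtho.topologicalClosure (horth hij)) ?_
  refine eq_top_iff.mpr (hdense.symm.le.trans ?_)
  exact Submodule.topologicalClosure_mono
    (iSup_mono fun i => Submodule.le_topologicalClosure (N i))

/-! ### STEP 4: `v = Σ_i P_i v` in an internal Hilbert sum -/

section HasSum

variable [CompleteSpace E] {ι : Type*} {L : ι → Submodule 𝕜 E}
  [∀ i, (L i).HasOrthogonalProjection]
  (hL : IsHilbertSum 𝕜 (fun i => L i) fun i => (L i).subtypeₗᵢ)
include hL

/-- The `i`-th coordinate of `v` in the canonical isometry `E ≃ₗᵢ ℓ²(L i)` is its orthogonal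
projection onto `L i`. -/
theorem starProjection_eq_linearIsometryEquiv_apply (v : E) (i : ι) :
    (L i).starProjection v = (hL.linearIsometryEquiv v i : E) := by
  set w := hL.linearIsometryEquiv v with hw
  have h1 : HasSum (fun j => ((w j : L j) : E)) v := by
    have := hL.hasSum_linearIsometryEquiv_symm w
    rwa [hw, LinearIsometryEquiv.symm_apply_apply] at this
  have h3 : HasSum (fun j => (L i).starProjection ((w j : L j) : E)) ((L i).starProjection v) :=
    h1.mapL ((L i).starProjection)
  have h4 : HasSum (fun j => (L i).starProjection ((w j : L j) : E)) ((w i : L i) : E) := by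
    have h5 : ∀ j, j ≠ i → (L i).starProjection ((w j : L j) : E) = 0 := fun j hj =>
      (Submodule.starProjection_apply_eq_zero_iff (L i)).mpr ((hL.OrthogonalFamily.isOrtho hj).le (w j).2)
    have := hasSum_single i h5
    rwa [Submodule.starProjection_eq_self_iff.mpr (w i).2] at this
  exact h3.unique h4

/-- STEP 4: the orthogonal projections of `v` onto the summands of an internal Hilbert sum sum
to `v`. -/
theorem hasSum_starProjection (v : E) : HasSum (fun i => (L i).starProjection v) v := by
  have h1 := hL.hasSum_linearIsometryEquiv_symm (hL.linearIsometryEquiv v)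
  rw [LinearIsometryEquiv.symm_apply_apply] at h1
  convert h1 using 2 with i
  exact starProjection_eq_linearIsometryEquiv_apply hL v i

/-- A non-zero vector has a non-zero component. -/
theorem exists_starProjection_ne_zero_of_ne_zero {v : E} (hv : v ≠ 0) :
    ∃ i, (L i).starProjection v ≠ 0 := by
  by_contra h
  have h' : ∀ i, (L i).starProjection v = 0 := fun i => by
    by_contra hi
    exact h ⟨i, hi⟩
  have h1 := hasSum_starProjection hL v
  simp only [h'] at h1
  exact hv (h1.unique hasSum_zero)

/-- If all components of `v` but the `i₀`-th vanish, `v` is its `i₀`-th component. -/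
theorem eq_starProjection_of_forall_ne {v : E} (i₀ : ι)
    (h : ∀ i, i ≠ i₀ → (L i).starProjection v = 0) : v = (L i₀).starProjection v :=
  (hasSum_starProjection hL v).unique (hasSum_single i₀ h)

/-- `v` lies in the summand `L i₀` iff all its other components vanish. -/
theorem mem_iff_forall_starProjection_eq_zero {v : E} (i₀ : ι) :
    v ∈ L i₀ ↔ ∀ i, i ≠ i₀ → (L i).starProjection v = 0 := by
  constructor
  · intro hv i hi
    exact (Submodule.starProjection_apply_eq_zero_iff (L i)).mpr
      ((hL.OrthogonalFamily.isOrtho (Ne.symm hi)).le hv)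
  · intro h
    rw [eq_starProjection_of_forall_ne hL i₀ h]
    exact Submodule.starProjection_apply_mem _ _

end HasSum

end Summit.Ventures.HodgeRepro2.T5HilbertSumProjections
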